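import Summits.HodgeConjecture.CorCM.Census.CentralSquaresTieCorners

/-!
# The square-central class, XV: potentials, nearest base changes and FORCING at the tie corners (`m = 2` building blocks)

COR-CM (cell `pub-hodgecm2`), count-neutral kernel combinatorics by the binder seat b09 (gen 45; lane SQUARE-CENTRAL CLASS, part XV), on parts III–IV and XIV
(`bpot_eq_card_dev_of_le`, `unique_T₀_of_lt`, `ddist_compl_eq`, `card_symmDiff_union`, `unique_T₀_of_mixed_pair`), BY NAME.  Theorems only; no `decide`,
no certificate, no named fact, no `sorry`.  HONEST FRAMING: `HC_CM` is NOT proved, here or anywhere in the tree; nothing here is a period or a headline.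

For the tie corner `X = ⟨p, q, q'⟩` of the four-type frame (one deviation place `p` on one side of `𝓗`, two `q ≠ q'` on the other; `m ≥ 2`):
* `unique_T₀_of_single`: single flips have `T₀` as unique nearest base change;
* `nearest_shapeA` / `nearest_shapeB`: `bpot X = 3` and the nearest base changes of `X` are among `{T₀, T̄₁}` (shape A: `p ∈ 𝓗`) resp. `{T₀, T₁}` (shape B);
* `strict_triple_tie_corner`: `(1, q, q')` is a strict lowering triple at `X` (so a strict cover IS strict there);
* `strict_place_ne_shapeA` / `strict_place_ne_shapeB` (**forcing, `m = 2`**): a strict triple at `X` toward `T₀` never flips `p` — its places are `{q, q'}` —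
  because the corner `⟨q, q'⟩` is a tie (`T₀`/`T̄₁` resp. `T₀`/`T₁`).
With part XIV this pins down the direction-`T₀` normal form at the corners of the designated pair face (design note `CENTRAL-SQUARES.md` §4).

## References
* [Pohlmann1968] H. Pohlmann, Algebraic cycles on abelian varieties of complex multiplication type, Ann. of Math. 88 (1968), Thm 1.
* [Milne1999] J. S. Milne, Lefschetz motives and the Tate conjecture, Compositio Math. 117 (1999), Prop. 2.1, p. 54.
-/

namespace Summit.HodgeConjecture.CorCM.Census.CentralSquares

open Finset
open scoped symmDiff
open Summit.HodgeConjecture.CorCM.Prior.AllgGroup.RfwfAllgGroup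
open Summit.HodgeConjecture.CorCM.Census.BlockParity
open Summit.HodgeConjecture.CorCM.Census.Coinvariant
open Summit.HodgeConjecture.CorCM.Census.TwistGeneration
open Summit.HodgeConjecture.CorCM.Census.BaseBlock
open Summit.HodgeConjecture.CorCM.Census.CoverClosure

noncomputable section

variable {G : Type*} [Group G] [Fintype G] [DecidableEq G] (c : G)

section Frame

variable (hc2 : c * c = 1) (hcen : ∀ x : G, x * c = c * x) (T₀ T₁ : CMF G c)
variable (hbase : ∀ Q : G, rt c Q T₀ = T₀ ∨ rt c Q T₀ = rt c c T₀ ∨ rt c Q T₀ = T₁ ∨ rt c Q T₀ = rt c c T₁)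
variable (m : ℕ) (hn : T₀.1.card = 4 * m) (hH : (T₀.1 \ T₁.1).card = 2 * m)

/-! ## §1 Single flips and the potential of the tie corner -/

include hc2 hcen hbase hn hH in
/-- A single flip of `T₀` has `T₀` as its unique nearest base change (`m ≥ 2`; `bpot = 1`). [folklore] -/
theorem unique_T₀_of_single (hm : 2 ≤ m) {p : G} (hp0 : p ∈ T₀.1) (Y : CMF G c) (hY : T₀.1 \ Y.1 = {p}) :
    bpot c T₀ Y = 1 ∧ ∀ Q' : G, ddist (rt c Q' T₀) Y = bpot c T₀ Y → rt c Q' T₀ = rt c (1 : G) T₀ := by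
  have hcard : (T₀.1 \ Y.1).card = 1 := by rw [hY, card_singleton]
  -- `|𝓗 ∆ {p}| = 2m ± 1`
  have hsd : 2 * m - 1 ≤ ((T₀.1 \ T₁.1) ∆ (T₀.1 \ Y.1)).card ∧ ((T₀.1 \ T₁.1) ∆ (T₀.1 \ Y.1)).card ≤ 2 * m + 1 := by
    rw [hY]
    by_cases hp1 : p ∈ T₁.1
    · have e : ({p} : Finset G) = ∅ ∪ {p} := by rw [empty_union]
      rw [e, card_symmDiff_union _ ∅ {p} (empty_subset _) (disjoint_singleton_left.mpr fun h => (mem_sdiff.mp h).2 hp1), hH,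
        card_empty, card_singleton]; omega
    · have e : ({p} : Finset G) = {p} ∪ ∅ := by rw [union_empty]
      rw [e, card_symmDiff_union _ {p} ∅ (singleton_subset_iff.mpr (mem_sdiff.mpr ⟨hp0, hp1⟩)) (disjoint_empty_left _), hH,
        card_empty, card_singleton]; omega
  have h1 : (T₀.1 \ Y.1).card < T₀.1.card - (T₀.1 \ Y.1).card := by rw [hcard, hn]; omega
  have h2 : (T₀.1 \ Y.1).card < ((T₀.1 \ T₁.1) ∆ (T₀.1 \ Y.1)).card := by rw [hcard]; omega
  have h3 : (T₀.1 \ Y.1).card < T₀.1.card - ((T₀.1 \ T₁.1) ∆ (T₀.1 \ Y.1)).card := by rw [hcard, hn]; omega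
  refine ⟨?_, unique_T₀_of_lt c T₀ T₁ hbase hc2 hcen Y h1 h2 h3⟩
  rw [← hcard]; exact bpot_eq_card_dev_of_le c T₀ T₁ hbase hc2 hcen Y h1.le h2.le h3.le

include hH in
/-- For the tie corner of shape A (`p ∈ 𝓗`, `q, q' ∉ 𝓗`): `|𝓗 ∆ {p, q, q'}| = 2m + 1`. [folklore] -/
theorem card_symmDiff_shapeA {p q q' : G} (hp : p ∈ T₀.1 \ T₁.1) (hq : q ∈ T₀.1 ∩ T₁.1) (hq' : q' ∈ T₀.1 ∩ T₁.1) (hqq' : q ≠ q') :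
    ((T₀.1 \ T₁.1) ∆ ({p, q, q'} : Finset G)).card = 2 * m + 1 := by
  have e : ({p, q, q'} : Finset G) = {p} ∪ {q, q'} := by ext x; simp only [mem_insert, mem_singleton, mem_union]
  have hpos : 1 ≤ (T₀.1 \ T₁.1).card := card_pos.mpr ⟨p, hp⟩
  rw [hH] at hpos
  rw [e, card_symmDiff_union _ {p} {q, q'} (singleton_subset_iff.mpr hp) ?_, hH, card_singleton, card_pair hqq']
  · omega
  · rw [disjoint_iff_ne]
    rintro x hx y hy rfl
    rw [mem_insert, mem_singleton] at hx
    rcases hx with rfl | rfl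
    · exact (mem_sdiff.mp hy).2 (mem_inter.mp hq).2
    · exact (mem_sdiff.mp hy).2 (mem_inter.mp hq').2

include hH in
/-- For the tie corner of shape B (`p ∉ 𝓗`, `q, q' ∈ 𝓗`): `|𝓗 ∆ {p, q, q'}| = 2m − 1`. [folklore] -/
theorem card_symmDiff_shapeB {p q q' : G} (hp : p ∈ T₀.1 ∩ T₁.1) (hq : q ∈ T₀.1 \ T₁.1) (hq' : q' ∈ T₀.1 \ T₁.1) (hqq' : q ≠ q') :
    ((T₀.1 \ T₁.1) ∆ ({p, q, q'} : Finset G)).card = 2 * m - 1 := by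
  have e : ({p, q, q'} : Finset G) = {q, q'} ∪ {p} := by
    ext x; simp only [mem_insert, mem_singleton, mem_union]; tauto
  have hsub : ({q, q'} : Finset G) ⊆ T₀.1 \ T₁.1 := by
    intro x hx; rw [mem_insert, mem_singleton] at hx
    rcases hx with rfl | rfl
    · exact hq
    · exact hq'
  have hpos : 1 ≤ (T₀.1 \ T₁.1).card := card_pos.mpr ⟨q, hq⟩
  rw [hH] at hpos
  rw [e, card_symmDiff_union _ {q, q'} {p} hsub (disjoint_singleton_left.mpr fun h => (mem_sdiff.mp h).2 (mem_inter.mp hp).2), hH,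
    card_singleton, card_pair hqq']
  omega

include hc2 hcen hbase hn hH in
/-- **The tie corner of shape A has potential `3`, and its nearest base changes are among `T₀`, `T̄₁`** (`m ≥ 2`; at `m = 2` both, at `m ≥ 3` only `T₀`).
[folklore] -/
theorem nearest_shapeA (hm : 2 ≤ m) {p q q' : G} (hp : p ∈ T₀.1 \ T₁.1) (hq : q ∈ T₀.1 ∩ T₁.1) (hq' : q' ∈ T₀.1 ∩ T₁.1)
    (hqq' : q ≠ q') (X : CMF G c) (hX : T₀.1 \ X.1 = {p, q, q'}) :
    bpot c T₀ X = 3 ∧ ∀ Q' : G, ddist (rt c Q' T₀) X = bpot c T₀ X → rt c Q' T₀ = T₀ ∨ rt c Q' T₀ = rt c c T₁ := by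
  have hpq : p ≠ q := fun h => (mem_sdiff.mp hp).2 (h ▸ (mem_inter.mp hq).2)
  have hpq' : p ≠ q' := fun h => (mem_sdiff.mp hp).2 (h ▸ (mem_inter.mp hq').2)
  have hcard : (T₀.1 \ X.1).card = 3 := by
    rw [hX, card_insert_of_notMem (by rw [mem_insert, mem_singleton]; push Not; exact ⟨hpq, hpq'⟩), card_pair hqq']
  have hsd : ((T₀.1 \ T₁.1) ∆ (T₀.1 \ X.1)).card = 2 * m + 1 := by rw [hX]; exact card_symmDiff_shapeA c T₀ T₁ m hH hp hq hq' hqq'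
  have hbp : bpot c T₀ X = 3 := by
    rw [← hcard]
    refine bpot_eq_card_dev_of_le c T₀ T₁ hbase hc2 hcen X ?_ ?_ ?_
    · rw [hcard, hn]; omega
    · rw [hcard, hsd]; omega
    · rw [hcard, hsd, hn]; omega
  refine ⟨hbp, fun Q' hQ' => ?_⟩
  rcases hbase Q' with h | h | h | h
  · exact Or.inl h
  · exfalso; rw [h, ddist_compl_base_eq c T₀ hc2 hcen, hbp, hn, hcard] at hQ'; omega
  · exfalso; rw [h, ddist_eq_card_symmDiff c T₀ hc2, hbp, hsd] at hQ'; omega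
  · exact Or.inr h

include hc2 hcen hbase hn hH in
/-- **The tie corner of shape B has potential `3`, and its nearest base changes are among `T₀`, `T₁`** (`m ≥ 2`). [folklore] -/
theorem nearest_shapeB (hm : 2 ≤ m) {p q q' : G} (hp : p ∈ T₀.1 ∩ T₁.1) (hq : q ∈ T₀.1 \ T₁.1) (hq' : q' ∈ T₀.1 \ T₁.1)
    (hqq' : q ≠ q') (X : CMF G c) (hX : T₀.1 \ X.1 = {p, q, q'}) :
    bpot c T₀ X = 3 ∧ ∀ Q' : G, ddist (rt c Q' T₀) X = bpot c T₀ X → rt c Q' T₀ = T₀ ∨ rt c Q' T₀ = T₁ := by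
  have hpq : p ≠ q := fun h => (mem_sdiff.mp hq).2 (h ▸ (mem_inter.mp hp).2)
  have hpq' : p ≠ q' := fun h => (mem_sdiff.mp hq').2 (h ▸ (mem_inter.mp hp).2)
  have hcard : (T₀.1 \ X.1).card = 3 := by
    rw [hX, card_insert_of_notMem (by rw [mem_insert, mem_singleton]; push Not; exact ⟨hpq, hpq'⟩), card_pair hqq']
  have hsd : ((T₀.1 \ T₁.1) ∆ (T₀.1 \ X.1)).card = 2 * m - 1 := by rw [hX]; exact card_symmDiff_shapeB c T₀ T₁ m hH hp hq hq' hqq'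
  have hbp : bpot c T₀ X = 3 := by
    rw [← hcard]
    refine bpot_eq_card_dev_of_le c T₀ T₁ hbase hc2 hcen X ?_ ?_ ?_
    · rw [hcard, hn]; omega
    · rw [hcard, hsd]; omega
    · rw [hcard, hsd, hn]; omega
  refine ⟨hbp, fun Q' hQ' => ?_⟩
  rcases hbase Q' with h | h | h | h
  · exact Or.inl h
  · exfalso; rw [h, ddist_compl_base_eq c T₀ hc2 hcen, hbp, hn, hcard] at hQ'; omega
  · exact Or.inr (Or.inl h |>.elim id id)
  · exfalso; rw [h, ddist_compl_eq c T₀ hc2 hcen, hbp, hsd, hn] at hQ'; omega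

/-! ## §2 The strict triple `(1, q, q')` exists; at `m = 2` a strict triple toward `T₀` never flips `p` -/

include hc2 hcen hbase hn hH in
/-- **A strict triple at the tie corner**: `(1, q, q')` — nearest base change `T₀`, places `q, q'`, and the three corners `⟨p, q'⟩`, `⟨p, q⟩`, `⟨p⟩` have
`T₀` as their unique nearest base change (`m ≥ 2`, both shapes). So a strict lowering cover is strict there. [folklore] -/
theorem strict_triple_tie_corner (hm : 2 ≤ m) {p q q' : G} (hp0 : p ∈ T₀.1) (hq0 : q ∈ T₀.1) (hq0' : q' ∈ T₀.1) (hqq' : q ≠ q')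
    (hpq : p ∈ T₁.1 ↔ q ∉ T₁.1) (hpq' : p ∈ T₁.1 ↔ q' ∉ T₁.1) (X : CMF G c) (hX : T₀.1 \ X.1 = {p, q, q'})
    (hbp : bpot c T₀ X = 3) :
    bpot c T₀ X = ddist (rt c (1 : G) T₀) X ∧ q ∈ (rt c (1 : G) T₀).1 \ X.1 ∧ q' ∈ (rt c (1 : G) T₀).1 \ X.1 ∧ q ≠ q' ∧
      (∀ Q' : G, ddist (rt c Q' T₀) (oflipCM c hc2 q X) = bpot c T₀ (oflipCM c hc2 q X) → rt c Q' T₀ = rt c (1 : G) T₀) ∧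
      (∀ Q' : G, ddist (rt c Q' T₀) (oflipCM c hc2 q' X) = bpot c T₀ (oflipCM c hc2 q' X) → rt c Q' T₀ = rt c (1 : G) T₀) ∧
      (∀ Q' : G, ddist (rt c Q' T₀) (oflipCM c hc2 q (oflipCM c hc2 q' X)) = bpot c T₀ (oflipCM c hc2 q (oflipCM c hc2 q' X)) →
        rt c Q' T₀ = rt c (1 : G) T₀) := by
  have hpq0 : p ≠ q := fun h => by rw [h] at hpq; exact iff_not_self hpq
  have hpq0' : p ≠ q' := fun h => by rw [h] at hpq'; exact iff_not_self hpq'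
  have hcard : (T₀.1 \ X.1).card = 3 := by
    rw [hX, card_insert_of_notMem (by rw [mem_insert, mem_singleton]; push Not; exact ⟨hpq0, hpq0'⟩), card_pair hqq']
  have hq : q ∈ T₀.1 \ X.1 := by rw [hX]; simp
  have hq' : q' ∈ T₀.1 \ X.1 := by rw [hX]; simp
  have hdq : T₀.1 \ (oflipCM c hc2 q X).1 = {p, q'} := by
    rw [dev_oflip c hc2 (mem_sdiff.mp hq).1 (mem_sdiff.mp hq).2, hX]
    ext x; simp only [mem_erase, mem_insert, mem_singleton]
    constructor
    · rintro ⟨hx, h | h | h⟩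
      · exact Or.inl h
      · exact absurd h hx
      · exact Or.inr h
    · rintro (rfl | rfl)
      · exact ⟨hpq0, Or.inl rfl⟩
      · exact ⟨hqq'.symm, Or.inr (Or.inr rfl)⟩
  have hdq' : T₀.1 \ (oflipCM c hc2 q' X).1 = {p, q} := by
    rw [dev_oflip c hc2 (mem_sdiff.mp hq').1 (mem_sdiff.mp hq').2, hX]
    ext x; simp only [mem_erase, mem_insert, mem_singleton]
    constructor
    · rintro ⟨hx, h | h | h⟩
      · exact Or.inl h
      · exact Or.inr h
      · exact absurd h hx
    · rintro (rfl | rfl)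
      · exact ⟨hpq0', Or.inl rfl⟩
      · exact ⟨hqq', Or.inr (Or.inl rfl)⟩
  have hq'' : q ∈ T₀.1 \ (oflipCM c hc2 q' X).1 := by rw [hdq']; simp
  have hdqq' : T₀.1 \ (oflipCM c hc2 q (oflipCM c hc2 q' X)).1 = {p} := by
    rw [dev_oflip c hc2 (mem_sdiff.mp hq'').1 (mem_sdiff.mp hq'').2, hdq']
    ext x; simp only [mem_erase, mem_insert, mem_singleton]
    constructor
    · rintro ⟨hx, h | h⟩
      · exact h
      · exact absurd h hx
    · rintro rfl; exact ⟨hpq0, Or.inl rfl⟩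
  refine ⟨by rw [rt_one, ddist_base_eq, hbp, hcard], by rw [rt_one]; exact hq, by rw [rt_one]; exact hq', hqq', ?_, ?_, ?_⟩
  · exact (unique_T₀_of_mixed_pair c hc2 hcen T₀ T₁ hbase m hn hH hm hp0 hq0' hpq0' hpq' _ hdq).2
  · exact (unique_T₀_of_mixed_pair c hc2 hcen T₀ T₁ hbase m hn hH hm hp0 hq0 hpq0 hpq _ hdq').2
  · exact (unique_T₀_of_single c hc2 hcen T₀ T₁ hbase m hn hH hm hp0 _ hdqq').2

include hc2 hcen hbase hn hH in
/-- **FORCING at `m = 2`, shape A.**  At the tie corner `⟨p, q, q'⟩` (`p ∈ 𝓗`, `q, q' ∉ 𝓗`) with `m = 2`, a lowering triple with nearest base change `T₀`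
whose corner at its first place has `T₀` as UNIQUE nearest base change does not flip `p`: the corner `⟨q, q'⟩` is a tie between `T₀` and `T̄₁`
(given an element `R` with `T₀·R⁻¹ = T̄₁`). [folklore] -/
theorem strict_place_ne_shapeA (hm : m = 2) {p q q' : G} (hp : p ∈ T₀.1 \ T₁.1) (hq : q ∈ T₀.1 ∩ T₁.1) (hq' : q' ∈ T₀.1 ∩ T₁.1)
    (hqq' : q ≠ q') (X : CMF G c) (hX : T₀.1 \ X.1 = {p, q, q'}) (R : G) (hR : rt c R T₀ = rt c c T₁) {s : G}
    (hu : ∀ Q' : G, ddist (rt c Q' T₀) (oflipCM c hc2 s X) = bpot c T₀ (oflipCM c hc2 s X) → rt c Q' T₀ = rt c (1 : G) T₀) :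
    s ≠ p := by
  rintro rfl
  have hpq : s ≠ q := fun h => (mem_sdiff.mp hp).2 (h ▸ (mem_inter.mp hq).2)
  have hpq' : s ≠ q' := fun h => (mem_sdiff.mp hp).2 (h ▸ (mem_inter.mp hq').2)
  have hs : s ∈ T₀.1 \ X.1 := by rw [hX]; simp
  have hdev : T₀.1 \ (oflipCM c hc2 s X).1 = {q, q'} := by
    rw [dev_oflip c hc2 (mem_sdiff.mp hs).1 (mem_sdiff.mp hs).2, hX]
    ext x; simp only [mem_erase, mem_insert, mem_singleton]
    constructor
    · rintro ⟨hx, h | h | h⟩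
      · exact absurd h hx
      · exact Or.inl h
      · exact Or.inr h
    · rintro (rfl | rfl)
      · exact ⟨hpq.symm, Or.inr (Or.inl rfl)⟩
      · exact ⟨hpq'.symm, Or.inr (Or.inr rfl)⟩
  set Y := oflipCM c hc2 s X with hYdef
  have hcard : (T₀.1 \ Y.1).card = 2 := by rw [hdev, card_pair hqq']
  -- `|𝓗 ∆ {q, q'}| = 2m + 2`
  have hsd : ((T₀.1 \ T₁.1) ∆ (T₀.1 \ Y.1)).card = 2 * m + 2 := by
    rw [hdev]
    have e : ({q, q'} : Finset G) = ∅ ∪ {q, q'} := by rw [empty_union]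
    rw [e, card_symmDiff_union _ ∅ {q, q'} (empty_subset _) ?_, hH, card_empty, card_pair hqq']
    · omega
    · rw [disjoint_iff_ne]
      rintro x hx y hy rfl
      rw [mem_insert, mem_singleton] at hx
      rcases hx with rfl | rfl
      · exact (mem_sdiff.mp hy).2 (mem_inter.mp hq).2
      · exact (mem_sdiff.mp hy).2 (mem_inter.mp hq').2
  have hbp : bpot c T₀ Y = 2 := by
    rw [← hcard]
    refine bpot_eq_card_dev_of_le c T₀ T₁ hbase hc2 hcen Y ?_ ?_ ?_
    · rw [hcard, hn]; omega
    · rw [hcard, hsd]; omega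
    · rw [hcard, hsd, hn]; omega
  -- `T̄₁` is also nearest: distance `|T₀| − (2m + 2) = 2`
  have hd : ddist (rt c R T₀) Y = bpot c T₀ Y := by rw [hR, ddist_compl_eq c T₀ hc2 hcen, hbp, hsd, hn]; omega
  have h := hu R hd
  rw [hR, rt_one] at h
  -- `T̄₁ = T₀` is absurd: their distance is `2m ≠ 0`
  have h0 := ddist_compl_eq c T₀ hc2 hcen T₁ T₀
  have e0 : (T₀.1 \ T₁.1) ∆ (T₀.1 \ T₀.1) = T₀.1 \ T₁.1 := by rw [Finset.sdiff_self]; exact symmDiff_bot _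
  rw [h, e0, hH, hn, ddist_base_eq, Finset.sdiff_self, card_empty] at h0
  omega

include hc2 hcen hbase hn hH in
/-- **FORCING at `m = 2`, shape B.**  At the tie corner `⟨p, q, q'⟩` (`p ∉ 𝓗`, `q, q' ∈ 𝓗`) with `m = 2`, a lowering triple with nearest base change
`T₀` whose corner at its first place has `T₀` as unique nearest base change does not flip `p`: the corner `⟨q, q'⟩ ⊆ 𝓗` is a tie between `T₀` and `T₁`.
[folklore] -/
theorem strict_place_ne_shapeB (hm : m = 2) {p q q' : G} (hp : p ∈ T₀.1 ∩ T₁.1) (hq : q ∈ T₀.1 \ T₁.1) (hq' : q' ∈ T₀.1 \ T₁.1)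
    (hqq' : q ≠ q') (X : CMF G c) (hX : T₀.1 \ X.1 = {p, q, q'}) (Q : G) (hQ : rt c Q T₀ = T₁) {s : G}
    (hu : ∀ Q' : G, ddist (rt c Q' T₀) (oflipCM c hc2 s X) = bpot c T₀ (oflipCM c hc2 s X) → rt c Q' T₀ = rt c (1 : G) T₀) :
    s ≠ p := by
  rintro rfl
  have hpq : s ≠ q := fun h => (mem_sdiff.mp hq).2 (h ▸ (mem_inter.mp hp).2)
  have hpq' : s ≠ q' := fun h => (mem_sdiff.mp hq').2 (h ▸ (mem_inter.mp hp).2)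
  have hs : s ∈ T₀.1 \ X.1 := by rw [hX]; simp
  have hdev : T₀.1 \ (oflipCM c hc2 s X).1 = {q, q'} := by
    rw [dev_oflip c hc2 (mem_sdiff.mp hs).1 (mem_sdiff.mp hs).2, hX]
    ext x; simp only [mem_erase, mem_insert, mem_singleton]
    constructor
    · rintro ⟨hx, h | h | h⟩
      · exact absurd h hx
      · exact Or.inl h
      · exact Or.inr h
    · rintro (rfl | rfl)
      · exact ⟨hpq.symm, Or.inr (Or.inl rfl)⟩
      · exact ⟨hpq'.symm, Or.inr (Or.inr rfl)⟩
  set Y := oflipCM c hc2 s X with hYdef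
  have hcard : (T₀.1 \ Y.1).card = 2 := by rw [hdev, card_pair hqq']
  have hsub : ({q, q'} : Finset G) ⊆ T₀.1 \ T₁.1 := by
    intro x hx; rw [mem_insert, mem_singleton] at hx
    rcases hx with rfl | rfl
    · exact hq
    · exact hq'
  have hsd : ((T₀.1 \ T₁.1) ∆ (T₀.1 \ Y.1)).card = 2 * m - 2 := by
    rw [hdev, symmDiff_of_ge hsub, card_sdiff_of_subset hsub, hH, card_pair hqq']
  have hbp : bpot c T₀ Y = 2 := by
    rw [← hcard]
    refine bpot_eq_card_dev_of_le c T₀ T₁ hbase hc2 hcen Y ?_ ?_ ?_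
    · rw [hcard, hn]; omega
    · rw [hcard, hsd]; omega
    · rw [hcard, hsd, hn]; omega
  have hd : ddist (rt c Q T₀) Y = bpot c T₀ Y := by rw [hQ, ddist_eq_card_symmDiff c T₀ hc2, hbp, hsd]; omega
  have h := hu Q hd
  rw [hQ, rt_one] at h
  have h0 : (T₀.1 \ T₁.1).card = 0 := by rw [h, Finset.sdiff_self, card_empty]
  omega

end Frame

end

end Summit.HodgeConjecture.CorCM.Census.CentralSquares
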